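import Mathlib
import HarnessLib
import Summits.Ventures.LatticeQCDFlow.Exactness.CenteredExponentialMomentFloor
import Summits.Ventures.LatticeQCDFlow.Exactness.LatticeBlockEntropyFloor
import Summits.Ventures.LatticeQCDFlow.Exactness.LatticeBlockPartition
import Summits.Ventures.LatticeQCDFlow.Exactness.SphereLOFlowEffectiveActionConcentration
import Summits.Ventures.LatticeQCDFlow.Exactness.SphereLOFlowLocalizedSiteTerms

/-!
# The extensive floor for the reverse relative entropy of the exact leading-order flow sampler: `KL((Φ_{0→c})_*π̄ ‖ e^{−cS}π̄/Z_c) ≥ Σ_blocks log(1 + a_j²/8) − |Λ|·(12κ²υ²/(d−1))·c²·τ_m(c)`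

HONEST FRAMING: exact (Metropolis-corrected) sampling algorithms for lattice gauge theory;
figures of merit are autocorrelation/cost numbers at stated couplings and volumes; no
continuum-physics claim.

Venture `LatticeQCDFlow` (cell pub-lqcd), topic `Exactness`; FANOUT row 7 (`s0-cpn-null`: the
S0-D1 rung — 2D CP⁹, Lüscher's LO trivializing map inside HMC, Engel–Schaefer 2011).  NEW WORK of
the cell over this lineage's `Exactness/LatticeBlockEntropyFloor.lean` (the block tensorization
floor), `Exactness/LatticeBlockPartition.lean` (regrouping local terms by separated blocks),
`Exactness/CenteredExponentialMomentFloor.lean` (`log ∫e^{−(G−∫G)} ≥ log(1 + (∫|G−∫G|)²/8)`),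
`Exactness/SphereLOFlowLocalizedSiteTerms.lean` (the cone error of one localized site term),
GEN-15's closed form `S_eff = cS₀ − ∫_0^c u·V₀(Φ_{0→u})du` (`SphereLOFlowEffectiveAction`) and
`KL = ∫S_eff dπ̄ + log ∫e^{−cS}dπ̄` (`SphereFlowRelativeEntropy`); nothing is cited as a fact.
Printed counterparts, NAMED ONLY: the venture's barrier B1 `Scaling/Barriers.VolumeScalingOfTraining`
(lean-2/theory-2: the FORWARD relative entropy `KL(p ‖ q) ≥ 2δ²·#blocks` of a finite-range flow of a
product prior on finite state spaces, block defect `δ` a physics hypothesis) and Abbott et al. 2022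
§V ("for fixed models, quality scales exponentially in volume").  THIS FILE is the sphere-side,
REVERSE-entropy (training-objective) form for the EXACT leading-order trivializing flow of the
lattice CP(N−1)/O(N) action, with the cone tail in place of strict locality and every constant
explicit: the companion floor of GEN-16's ceiling `KL ≤ |Λ|·D²/8`
(`SphereLOFlowEffectiveActionConcentration`).

## Setting

E–S action on `Ω̃` (`d = dim E ≥ 2`, no self-coupling, adjoint pairs, local weight `Σ_m‖U_km‖ ≤ υ`);
`π̄ = ⊗_Λ σ̄`; `Φ_{0→u}` the exact LO flow; `0 ≤ c ≤ |T| + 1`; `K = 3|κ|υ/(d−1)`,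
`τ_m(c) = 2e^{Kc}(Kc)^{m+1}/(m+1)!`; `N n = {n} ∪ couplingNbhd U n`; a reference configuration
`e ∈ Ω̃`; localized site terms `g_n(ω) = −∫_0^c u·v_n(Φ_{0→u}(ω glued to e outside nball N (m+1) n))du`;
blocks `B_j` (`j ∈ T`) pairwise disjoint and SEPARATED for the radius-`(m+1)` balls (no ball meets
two blocks); corridors `C = Λ ∖ ⋃_j B_j`; block terms `h_j = Σ_{n : ball(n) ∩ B_j ≠ ∅} g_n`;
block fluctuations `a_j = ∫|A_C h_j − ∫h_j dπ̄| dπ̄` (`A_C` = average over the corridor coordinates).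

## Content

* §1 **`abs_effAction_loFlow_sub_local_le`** — `|S_eff − (cS₀ + Σ_n g_n)| ≤ |Λ|·(6κ²υ²/(d−1))·c²·τ_m(c)`.
* §2 **`sum_blocks_sub_le_klDiv_map_loFlow`** — exact-local form:
  `Σ_{j∈T} (∫h_j dπ̄ + log ∫e^{−A_C h_j} dπ̄) − |Λ|·(12κ²υ²/(d−1))·c²·τ_m(c) ≤ KL((Φ_{0→c})_*π̄ ‖ γ_c)`;
  **`sum_log_one_add_sq_sub_le_klDiv_map_loFlow`** — fluctuation form:
  `Σ_{j∈T} log(1 + a_j²/8) − |Λ|·(12κ²υ²/(d−1))·c²·τ_m(c) ≤ KL((Φ_{0→c})_*π̄ ‖ γ_c)`: at fixed flow time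
  the reverse relative entropy of the exact LO flow sampler is bounded BELOW by a sum over separated
  blocks of nonnegative block free-energy fluctuations (each `> 0` as soon as the block's conditional
  localized action is non-constant, `CenteredExponentialMomentFloor`), minus a cone tail of order
  `c^{m+3}` per site — LINEAR IN THE NUMBER OF BLOCKS whenever the `a_j` are bounded below;
  `integral_abs_coordAvg_sub_pos_of_ne` — `a_j > 0` as soon as `A_C h_j` is non-constant.

NOT CLAIMED: a lower bound on any `a_j` (model- and block-specific; its volume-uniformity is NOT
asserted — `g_n` is defined through the flow of the glued configuration in the given volume); the
forward entropy / ESS / acceptance ceilings; the Metropolis-corrected chain; the rung's one-step map;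
numbers.
-/

noncomputable section

namespace Summit.Ventures.LatticeQCDFlow.Exactness

open Function Set Metric MeasureTheory NormedSpace InnerProductSpace InformationTheory
open scoped RealInnerProductSpace Topology Nat Classical

variable {Λ : Type*} {E : Type*} [NormedAddCommGroup E] [InnerProductSpace ℝ E]
  [FiniteDimensional ℝ E] [Fintype Λ] [DecidableEq Λ]

/-! ## §1 The effective action as a sum of localized site terms, up to the cone tail -/

section Local

variable {U : Λ → Λ → (E →L[ℝ] E)} {T : ℝ}

set_option maxHeartbeats 400000 in
/-- **THE EFFECTIVE ACTION IS WITHIN `|Λ|·(6κ²υ²/(d−1))·c²·τ_m(c)` OF THE SUM OF ITS LOCALIZED SITE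
TERMS**: with `g_n(ω) = −∫_0^c u·v_n(Φ_{0→u}(ω glued to e outside nball N (m+1) n))du`,
`|S_eff(ω) − (c·S₀ + Σ_n g_n(ω))| ≤ |Λ|·(6κ²υ²/(d−1))·c²·τ_m(c)` for `0 ≤ c ≤ |T| + 1`
(GEN-15's closed form `S_eff = cS₀ − ∫_0^c u·V₀(Φ_{0→u})du` and the cone error site by site). -/
theorem abs_effAction_loFlow_sub_local_le (hU0 : ∀ n, U n n = 0)
    (hUadj : ∀ m n (v w : E), ⟪U m n v, w⟫ = ⟪v, U n m w⟫) (hd : 2 ≤ Module.finrank ℝ E)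
    (κ S₀ : ℝ) {υ : ℝ} (hυ : ∀ k, ∑ m, ‖U k m‖ ≤ υ) {e : Λ → E} (he : ∀ n, ‖e n‖ = 1) (m : ℕ)
    {c : ℝ} (hc0 : 0 ≤ c) (hc : c ≤ |T| + 1)
    {g : Λ → (Λ → sphere (0 : E) 1) → ℝ}
    (hg : ∀ n ω, g n ω = -∫ u in (0 : ℝ)..c, u * (2 * κ ^ 2 / ((Module.finrank ℝ E : ℝ) - 1) *
      ‖tangentKick (localField U n (sphereTDFlow (G := fun _ : ℝ => loFlowAction κ S₀ U)
          (contDiff_const_family (contDiff_loFlowAction U κ S₀)) T 0 u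
          ((nball (fun k => insert k (couplingNbhd U k)) (m + 1) n).piecewise
            (fun i => ((ω i : sphere (0 : E) 1) : E)) e)))
        (sphereTDFlow (G := fun _ : ℝ => loFlowAction κ S₀ U)
          (contDiff_const_family (contDiff_loFlowAction U κ S₀)) T 0 u
          ((nball (fun k => insert k (couplingNbhd U k)) (m + 1) n).piecewise
            (fun i => ((ω i : sphere (0 : E) 1) : E)) e) n)‖ ^ 2))
    (ω : Λ → sphere (0 : E) 1) :
    |(c * esAction κ S₀ U (sphereTDFlow (G := fun _ : ℝ => loFlowAction κ S₀ U)
          (contDiff_const_family (contDiff_loFlowAction U κ S₀)) T 0 c (fun i => (ω i : E))) -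
        sphereTDFlowLogJac (G := fun _ : ℝ => loFlowAction κ S₀ U)
          (contDiff_const_family (contDiff_loFlowAction U κ S₀)) T 0 c (fun i => (ω i : E))) -
        (c * S₀ + ∑ n, g n ω)| ≤
      Fintype.card Λ * (6 * κ ^ 2 * υ ^ 2 / ((Module.finrank ℝ E : ℝ) - 1) * c ^ 2 *
        (2 * Real.exp (3 * |κ| * υ / ((Module.finrank ℝ E : ℝ) - 1) * c) *
          (3 * |κ| * υ / ((Module.finrank ℝ E : ℝ) - 1) * c) ^ (m + 1) / ((m + 1)! : ℝ))) := by
  set N : Λ → Set Λ := fun k => insert k (couplingNbhd U k) with hN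
  set x : Λ → E := fun i => (ω i : E) with hxdef
  have hx : ∀ i, ‖x i‖ = 1 := norm_sphereConfig_eq_one ω
  have hc' : |c| ≤ |T| + 1 := by rwa [abs_of_nonneg hc0]
  set Φ : ℝ → (Λ → E) → (Λ → E) := fun u y => sphereTDFlow (G := fun _ : ℝ => loFlowAction κ S₀ U)
    (contDiff_const_family (contDiff_loFlowAction U κ S₀)) T 0 u y with hΦ
  set w : Λ → (Λ → E) → ℝ := fun n y =>
    2 * κ ^ 2 / ((Module.finrank ℝ E : ℝ) - 1) * ‖tangentKick (localField U n y) (y n)‖ ^ 2 with hw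
  set B : ℝ := 6 * κ ^ 2 * υ ^ 2 / ((Module.finrank ℝ E : ℝ) - 1) * c ^ 2 *
    (2 * Real.exp (3 * |κ| * υ / ((Module.finrank ℝ E : ℝ) - 1) * c) *
      (3 * |κ| * υ / ((Module.finrank ℝ E : ℝ) - 1) * c) ^ (m + 1) / ((m + 1)! : ℝ)) with hB
  -- GEN-15's closed form of the effective action
  have heff := effAction_loFlow_eq hU0 hUadj hd κ S₀ hx hc' (T := T)
  -- the integrand as a site sum, and the sum pulled out of the flow-time integral
  have hsum : ∀ u, u * (2 * κ ^ 2 / ((Module.finrank ℝ E : ℝ) - 1) *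
      ∑ n, ‖tangentKick (localField U n (Φ u x)) (Φ u x n)‖ ^ 2) = ∑ n, u * w n (Φ u x) := by
    intro u; rw [Finset.mul_sum, Finset.mul_sum]
  have hint : ∫ u in (0 : ℝ)..c, u * (2 * κ ^ 2 / ((Module.finrank ℝ E : ℝ) - 1) *
      ∑ n, ‖tangentKick (localField U n (Φ u x)) (Φ u x n)‖ ^ 2) =
      ∑ n, ∫ u in (0 : ℝ)..c, u * w n (Φ u x) := by
    simp_rw [hsum]
    exact intervalIntegral.integral_finsetSum fun n _ =>
      (continuous_id.mul (continuous_loCarreSite_loFlow (U := U) κ S₀ n x (T := T))).intervalIntegrable _ _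
  have hrew : (c * esAction κ S₀ U (Φ c x) -
      sphereTDFlowLogJac (G := fun _ : ℝ => loFlowAction κ S₀ U)
        (contDiff_const_family (contDiff_loFlowAction U κ S₀)) T 0 c x) - (c * S₀ + ∑ n, g n ω) =
      -∑ n, ((∫ u in (0 : ℝ)..c, u * w n (Φ u x)) -
        ∫ u in (0 : ℝ)..c, u * w n (Φ u ((nball N (m + 1) n).piecewise x e))) := by
    have h1 : c * esAction κ S₀ U (Φ c x) -
        sphereTDFlowLogJac (G := fun _ : ℝ => loFlowAction κ S₀ U)
          (contDiff_const_family (contDiff_loFlowAction U κ S₀)) T 0 c x =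
        c * S₀ - ∑ n, ∫ u in (0 : ℝ)..c, u * w n (Φ u x) := by
      rw [← hint]; exact heff
    rw [h1, Finset.sum_sub_distrib]
    have h2 : ∑ n, g n ω = -∑ n, ∫ u in (0 : ℝ)..c, u * w n (Φ u ((nball N (m + 1) n).piecewise x e)) := by
      rw [← Finset.sum_neg_distrib]
      exact Finset.sum_congr rfl fun n _ => hg n ω
    rw [h2]; ring
  rw [hrew, abs_neg]
  refine (Finset.abs_sum_le_sum_abs _ _).trans ?_
  calc ∑ n, |(∫ u in (0 : ℝ)..c, u * w n (Φ u x)) -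
        ∫ u in (0 : ℝ)..c, u * w n (Φ u ((nball N (m + 1) n).piecewise x e))|
      ≤ ∑ _n : Λ, B := Finset.sum_le_sum fun n _ =>
        abs_intervalIntegral_loCarreSite_sub_le hU0 hUadj hd κ S₀ hυ hx he n m hc0 (T := T)
    _ = Fintype.card Λ * B := by rw [Finset.sum_const, Finset.card_univ, nsmul_eq_mul]

end Local

/-! ## §2 The extensive floor for the reverse relative entropy -/

section Floor

variable [MeasurableSpace E] [BorelSpace E] [Nontrivial E] {U : Λ → Λ → (E →L[ℝ] E)} {T : ℝ}

set_option maxHeartbeats 400000 in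
/-- **THE EXTENSIVE FLOOR, exact-local form.**  E–S action (`d ≥ 2`, no self-coupling, adjoint pairs,
local weight `≤ υ`), `0 ≤ c ≤ |T| + 1`, a reference configuration `e ∈ Ω̃`, the localized site terms
`g_n(ω) = −∫_0^c u·v_n(Φ_{0→u}(ω glued to e outside nball N (m+1) n))du`, blocks `B_j` (`j ∈ T`)
pairwise disjoint and separated for the radius-`(m+1)` balls, corridors `C = Λ ∖ ⋃_j B_j`, block
terms `h_j = Σ_{n : ball(n) meets B_j} g_n`.  Then
`Σ_{j∈T} (∫h_j dπ̄ + log ∫e^{−A_C h_j} dπ̄) − |Λ|·(12κ²υ²/(d−1))·c²·τ_m(c) ≤ KL((Φ_{0→c})_*π̄ ‖ e^{−cS}π̄/Z_c)`,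
`τ_m(c) = 2e^{Kc}(Kc)^{m+1}/(m+1)!`, `K = 3|κ|υ/(d−1)`. -/
theorem sum_blocks_sub_le_klDiv_map_loFlow (hU0 : ∀ n, U n n = 0)
    (hUadj : ∀ m n (v w : E), ⟪U m n v, w⟫ = ⟪v, U n m w⟫) (hd : 2 ≤ Module.finrank ℝ E)
    (κ S₀ : ℝ) {υ : ℝ} (hυ : ∀ k, ∑ m, ‖U k m‖ ≤ υ) {c : ℝ} (hc0 : 0 ≤ c) (hc : c ≤ |T| + 1)
    {e : Λ → E} (he : ∀ n, ‖e n‖ = 1) (m : ℕ)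
    {g : Λ → (Λ → sphere (0 : E) 1) → ℝ}
    (hg : ∀ n ω, g n ω = -∫ u in (0 : ℝ)..c, u * (2 * κ ^ 2 / ((Module.finrank ℝ E : ℝ) - 1) *
      ‖tangentKick (localField U n (sphereTDFlow (G := fun _ : ℝ => loFlowAction κ S₀ U)
          (contDiff_const_family (contDiff_loFlowAction U κ S₀)) T 0 u
          ((nball (fun k => insert k (couplingNbhd U k)) (m + 1) n).piecewise
            (fun i => ((ω i : sphere (0 : E) 1) : E)) e)))
        (sphereTDFlow (G := fun _ : ℝ => loFlowAction κ S₀ U)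
          (contDiff_const_family (contDiff_loFlowAction U κ S₀)) T 0 u
          ((nball (fun k => insert k (couplingNbhd U k)) (m + 1) n).piecewise
            (fun i => ((ω i : sphere (0 : E) 1) : E)) e) n)‖ ^ 2))
    {J : Type*} (Tb : Finset J) (B : J → Finset Λ)
    (hB : ∀ j ∈ Tb, ∀ j' ∈ Tb, j ≠ j' → Disjoint (B j) (B j'))
    (hsep : ∀ n, ∀ j ∈ Tb, ∀ j' ∈ Tb,
      ¬ Disjoint (nball (fun k => insert k (couplingNbhd U k)) (m + 1) n) ↑(B j) →
      ¬ Disjoint (nball (fun k => insert k (couplingNbhd U k)) (m + 1) n) ↑(B j') → j = j') :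
    ∑ j ∈ Tb, ((∫ ω, (∑ n ∈ Finset.univ.filter (fun n =>
          ¬ Disjoint (nball (fun k => insert k (couplingNbhd U k)) (m + 1) n) ↑(B j)), g n ω)
          ∂Measure.pi (fun _ : Λ => uniformSphere (volume : Measure E))) +
        Real.log (∫ ω, Real.exp (-coordAvg (uniformSphere (volume : Measure E))
          (Finset.univ \ Tb.biUnion B) (fun ω => ∑ n ∈ Finset.univ.filter (fun n =>
            ¬ Disjoint (nball (fun k => insert k (couplingNbhd U k)) (m + 1) n) ↑(B j)), g n ω) ω)
          ∂Measure.pi (fun _ : Λ => uniformSphere (volume : Measure E)))) -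
      Fintype.card Λ * (12 * κ ^ 2 * υ ^ 2 / ((Module.finrank ℝ E : ℝ) - 1) * c ^ 2 *
        (2 * Real.exp (3 * |κ| * υ / ((Module.finrank ℝ E : ℝ) - 1) * c) *
          (3 * |κ| * υ / ((Module.finrank ℝ E : ℝ) - 1) * c) ^ (m + 1) / ((m + 1)! : ℝ))) ≤
      (klDiv (Measure.map (sphereTDFlowMap (G := fun _ : ℝ => loFlowAction κ S₀ U)
          (contDiff_const_family (contDiff_loFlowAction U κ S₀)) T 0 c)
          (Measure.pi (fun _ : Λ => uniformSphere (volume : Measure E))))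
        ((Measure.pi (fun _ : Λ => uniformSphere (volume : Measure E))).tilted
          fun ω => -(c * esAction κ S₀ U (fun m => (ω m : E))))).toReal := by
  set N : Λ → Set Λ := fun k => insert k (couplingNbhd U k) with hN
  have hc' : |c| ≤ |T| + 1 := by rwa [abs_of_nonneg hc0]
  have h0 : |(0 : ℝ)| ≤ |T| + 1 := by rw [abs_zero]; positivity
  rw [toReal_klDiv_map_sphereTDFlowMap_tilted _ (contDiff_const_family (contDiff_loFlowAction U κ S₀))
    (contDiff_esAction U κ S₀) c h0 hc']
  set μ : Measure (Λ → sphere (0 : E) 1) := Measure.pi (fun _ : Λ => uniformSphere (volume : Measure E))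
    with hμ
  set F : (Λ → sphere (0 : E) 1) → ℝ := fun ω =>
    c * esAction κ S₀ U (sphereTDFlow (G := fun _ : ℝ => loFlowAction κ S₀ U)
        (contDiff_const_family (contDiff_loFlowAction U κ S₀)) T 0 c (fun m => (ω m : E))) -
      sphereTDFlowLogJac (G := fun _ : ℝ => loFlowAction κ S₀ U)
        (contDiff_const_family (contDiff_loFlowAction U κ S₀)) T 0 c (fun m => (ω m : E)) with hF
  have hFc : Continuous F := continuous_effAction_loFlow (U := U) κ S₀ c (T := T)
  -- the partition function is `∫ e^{−S_eff} dπ̄` (exact reweighting with `H = 1`)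
  have hZ : ∫ ω, Real.exp (-(c * esAction κ S₀ U (fun m => ((ω : Λ → sphere (0 : E) 1) m : E)))) ∂μ =
      ∫ ω, Real.exp (-F ω) ∂μ := by
    have hw := integral_loWeight_mul_comp_eq (U := U) κ S₀ (contDiff_const (c := (1 : ℝ))) hc' (T := T)
    simp only [mul_one] at hw
    rw [hμ, ← hw]
    refine integral_congr_ae (ae_of_all _ fun ω => ?_)
    simp only [hF, neg_sub]
  rw [hZ]
  -- the block data
  set h : J → (Λ → sphere (0 : E) 1) → ℝ := fun j ω =>
    ∑ n ∈ Finset.univ.filter (fun n => ¬ Disjoint (nball N (m + 1) n) ↑(B j)), g n ω with hh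
  set r : (Λ → sphere (0 : E) 1) → ℝ := fun ω =>
    c * S₀ + ∑ n ∈ Finset.univ.filter (fun n => ∀ j ∈ Tb, Disjoint (nball N (m + 1) n) ↑(B j)), g n ω
    with hr
  have hgc : ∀ n, Continuous (g n) := continuous_loLocalTerm (U := U) κ S₀ e m c hg (T := T)
  have hgdep : ∀ n, DependsOn (g n) (nball N (m + 1) n) := dependsOn_loLocalTerm (U := U) κ S₀ e m c hg (T := T)
  have hhc : ∀ j ∈ Tb, Continuous (h j) := fun j _ =>
    continuous_finsetSum _ fun n _ => hgc n
  have hhdep : ∀ j ∈ Tb, DependsOn (h j) (↑(B j) ∪ ↑(Finset.univ \ Tb.biUnion B)) := fun j hj =>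
    dependsOn_blockSum (fun n => nball N (m + 1) n) Tb B hsep hgdep hj
  have hrc : Continuous r := continuous_const.add (continuous_finsetSum _ fun n _ => hgc n)
  have hrdep : DependsOn r ↑(Finset.univ \ Tb.biUnion B) := by
    intro ω ω' hagree
    have hfree := dependsOn_freeSum (fun n => nball N (m + 1) n) Tb B hgdep hagree
    simp only at hfree
    show c * S₀ + _ = c * S₀ + _
    rw [hfree]
  -- the localization error
  have hδ : ∀ ω, |F ω - (∑ j ∈ Tb, h j ω + r ω)| ≤
      Fintype.card Λ * (6 * κ ^ 2 * υ ^ 2 / ((Module.finrank ℝ E : ℝ) - 1) * c ^ 2 *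
        (2 * Real.exp (3 * |κ| * υ / ((Module.finrank ℝ E : ℝ) - 1) * c) *
          (3 * |κ| * υ / ((Module.finrank ℝ E : ℝ) - 1) * c) ^ (m + 1) / ((m + 1)! : ℝ))) := by
    intro ω
    have hsplit : ∑ j ∈ Tb, h j ω + r ω = c * S₀ + ∑ n, g n ω := by
      rw [sum_eq_sum_blocks_add_sum_free (fun n => nball N (m + 1) n) Tb B hsep (fun n => g n ω)]
      simp only [hh, hr]
      ring
    rw [hsplit]
    exact abs_effAction_loFlow_sub_local_le hU0 hUadj hd κ S₀ hυ he m hc0 hc hg ω (T := T)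
  have hmain := sum_blocks_sub_le_integral_add_log_integral_exp_neg
    (uniformSphere (volume : Measure E)) Tb B hB (Finset.univ \ Tb.biUnion B) hhc hhdep hrc hrdep hFc hδ
  rw [← hμ] at hmain
  refine le_trans (le_of_eq ?_) hmain
  simp only [hh]
  ring

/-- **THE EXTENSIVE FLOOR, fluctuation form.**  In the setting of `sum_blocks_sub_le_klDiv_map_loFlow`,
with the block fluctuations `a_j = ∫|A_C h_j − ∫h_j dπ̄| dπ̄`:
`Σ_{j∈T} log(1 + a_j²/8) − |Λ|·(12κ²υ²/(d−1))·c²·τ_m(c) ≤ KL((Φ_{0→c})_*π̄ ‖ e^{−cS}π̄/Z_c)` — at fixed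
flow time the reverse relative entropy of the exact leading-order flow sampler is bounded BELOW by a
sum over separated blocks of nonnegative block free-energy fluctuations, minus a cone tail of order
`c^{m+3}` per site: linear in the number of blocks whenever the `a_j` are bounded below. -/
theorem sum_log_one_add_sq_sub_le_klDiv_map_loFlow (hU0 : ∀ n, U n n = 0)
    (hUadj : ∀ m n (v w : E), ⟪U m n v, w⟫ = ⟪v, U n m w⟫) (hd : 2 ≤ Module.finrank ℝ E)
    (κ S₀ : ℝ) {υ : ℝ} (hυ : ∀ k, ∑ m, ‖U k m‖ ≤ υ) {c : ℝ} (hc0 : 0 ≤ c) (hc : c ≤ |T| + 1)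
    {e : Λ → E} (he : ∀ n, ‖e n‖ = 1) (m : ℕ)
    {g : Λ → (Λ → sphere (0 : E) 1) → ℝ}
    (hg : ∀ n ω, g n ω = -∫ u in (0 : ℝ)..c, u * (2 * κ ^ 2 / ((Module.finrank ℝ E : ℝ) - 1) *
      ‖tangentKick (localField U n (sphereTDFlow (G := fun _ : ℝ => loFlowAction κ S₀ U)
          (contDiff_const_family (contDiff_loFlowAction U κ S₀)) T 0 u
          ((nball (fun k => insert k (couplingNbhd U k)) (m + 1) n).piecewise
            (fun i => ((ω i : sphere (0 : E) 1) : E)) e)))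
        (sphereTDFlow (G := fun _ : ℝ => loFlowAction κ S₀ U)
          (contDiff_const_family (contDiff_loFlowAction U κ S₀)) T 0 u
          ((nball (fun k => insert k (couplingNbhd U k)) (m + 1) n).piecewise
            (fun i => ((ω i : sphere (0 : E) 1) : E)) e) n)‖ ^ 2))
    {J : Type*} (Tb : Finset J) (B : J → Finset Λ)
    (hB : ∀ j ∈ Tb, ∀ j' ∈ Tb, j ≠ j' → Disjoint (B j) (B j'))
    (hsep : ∀ n, ∀ j ∈ Tb, ∀ j' ∈ Tb,
      ¬ Disjoint (nball (fun k => insert k (couplingNbhd U k)) (m + 1) n) ↑(B j) →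
      ¬ Disjoint (nball (fun k => insert k (couplingNbhd U k)) (m + 1) n) ↑(B j') → j = j') :
    ∑ j ∈ Tb, Real.log (1 + (∫ ω, |coordAvg (uniformSphere (volume : Measure E))
          (Finset.univ \ Tb.biUnion B) (fun ω => ∑ n ∈ Finset.univ.filter (fun n =>
            ¬ Disjoint (nball (fun k => insert k (couplingNbhd U k)) (m + 1) n) ↑(B j)), g n ω) ω -
          ∫ ω', (∑ n ∈ Finset.univ.filter (fun n =>
            ¬ Disjoint (nball (fun k => insert k (couplingNbhd U k)) (m + 1) n) ↑(B j)), g n ω')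
            ∂Measure.pi (fun _ : Λ => uniformSphere (volume : Measure E))|
          ∂Measure.pi (fun _ : Λ => uniformSphere (volume : Measure E))) ^ 2 / 8) -
      Fintype.card Λ * (12 * κ ^ 2 * υ ^ 2 / ((Module.finrank ℝ E : ℝ) - 1) * c ^ 2 *
        (2 * Real.exp (3 * |κ| * υ / ((Module.finrank ℝ E : ℝ) - 1) * c) *
          (3 * |κ| * υ / ((Module.finrank ℝ E : ℝ) - 1) * c) ^ (m + 1) / ((m + 1)! : ℝ))) ≤
      (klDiv (Measure.map (sphereTDFlowMap (G := fun _ : ℝ => loFlowAction κ S₀ U)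
          (contDiff_const_family (contDiff_loFlowAction U κ S₀)) T 0 c)
          (Measure.pi (fun _ : Λ => uniformSphere (volume : Measure E))))
        ((Measure.pi (fun _ : Λ => uniformSphere (volume : Measure E))).tilted
          fun ω => -(c * esAction κ S₀ U (fun m => (ω m : E))))).toReal := by
  set N : Λ → Set Λ := fun k => insert k (couplingNbhd U k) with hN
  have hmain := sum_blocks_sub_le_klDiv_map_loFlow hU0 hUadj hd κ S₀ hυ hc0 hc he m hg Tb B hB hsep (T := T)
  refine le_trans ?_ hmain
  set μ : Measure (Λ → sphere (0 : E) 1) := Measure.pi (fun _ : Λ => uniformSphere (volume : Measure E))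
    with hμ
  gcongr with j hj
  -- one block: `∫h_j + log ∫e^{−A_C h_j} = log ∫e^{−(A_C h_j − ∫A_C h_j)} ≥ log(1 + a_j²/8)`
  set hj' : (Λ → sphere (0 : E) 1) → ℝ := fun ω =>
    ∑ n ∈ Finset.univ.filter (fun n => ¬ Disjoint (nball N (m + 1) n) ↑(B j)), g n ω with hhj
  have hgc : ∀ n, Continuous (g n) := continuous_loLocalTerm (U := U) κ S₀ e m c hg (T := T)
  have hhc : Continuous hj' := continuous_finsetSum _ fun n _ => hgc n
  have hAc : Continuous (coordAvg (uniformSphere (volume : Measure E)) (Finset.univ \ Tb.biUnion B) hj') :=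
    continuous_coordAvg _ _ hhc
  have hmean : ∫ ω, coordAvg (uniformSphere (volume : Measure E)) (Finset.univ \ Tb.biUnion B) hj' ω ∂μ =
      ∫ ω, hj' ω ∂μ := integral_coordAvg _ _ hhc
  have heq := integral_add_log_integral_exp_neg_eq (uniformSphere (volume : Measure E)) hAc
  rw [← hμ] at heq
  rw [hmean] at heq
  change Real.log (1 + (∫ ω, |coordAvg (uniformSphere (volume : Measure E)) (Finset.univ \ Tb.biUnion B)
      hj' ω - ∫ ω', hj' ω' ∂μ| ∂μ) ^ 2 / 8) ≤
    (∫ ω, hj' ω ∂μ) + Real.log (∫ ω, Real.exp (-coordAvg (uniformSphere (volume : Measure E))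
      (Finset.univ \ Tb.biUnion B) hj' ω) ∂μ)
  rw [heq, ← hmean]
  have hAi : Integrable (coordAvg (uniformSphere (volume : Measure E)) (Finset.univ \ Tb.biUnion B) hj') μ :=
    integrable_pi_of_continuous _ hAc
  have hA2 : Integrable (fun ω => coordAvg (uniformSphere (volume : Measure E))
      (Finset.univ \ Tb.biUnion B) hj' ω ^ 2) μ := integrable_pi_of_continuous _ (hAc.pow 2)
  have hAe : Integrable (fun ω => Real.exp (-coordAvg (uniformSphere (volume : Measure E))
      (Finset.univ \ Tb.biUnion B) hj' ω)) μ :=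
    integrable_pi_of_continuous _ (Real.continuous_exp.comp hAc.neg)
  exact log_integral_exp_neg_sub_mean_ge hAi hA2 hAe

/-- **A BLOCK TERM IS STRICTLY POSITIVE AS SOON AS THE BLOCK'S CONDITIONAL ACTION IS NON-CONSTANT.**
For every continuous `h : Ω → ℝ` and every set of corridor coordinates `C`: if the corridor average
`A_C h` takes two different values, then its mean absolute deviation is positive,
`0 < ∫|A_C h − ∫h dπ̄| dπ̄`, hence `0 < log(1 + (∫|A_C h − ∫h dπ̄| dπ̄)²/8)` — the block fluctuations
`a_j` of the floor vanish only for blocks whose conditional localized action is constant (the a-priori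
law charges every open set of `Ω`). -/
theorem integral_abs_coordAvg_sub_pos_of_ne {h : (Λ → sphere (0 : E) 1) → ℝ} (hh : Continuous h)
    (C : Finset Λ) {ω₁ ω₂ : Λ → sphere (0 : E) 1}
    (hne : coordAvg (uniformSphere (volume : Measure E)) C h ω₁ ≠
      coordAvg (uniformSphere (volume : Measure E)) C h ω₂) :
    0 < ∫ ω, |coordAvg (uniformSphere (volume : Measure E)) C h ω -
        ∫ ω', h ω' ∂Measure.pi (fun _ : Λ => uniformSphere (volume : Measure E))|
        ∂Measure.pi (fun _ : Λ => uniformSphere (volume : Measure E)) ∧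
      0 < Real.log (1 + (∫ ω, |coordAvg (uniformSphere (volume : Measure E)) C h ω -
        ∫ ω', h ω' ∂Measure.pi (fun _ : Λ => uniformSphere (volume : Measure E))|
        ∂Measure.pi (fun _ : Λ => uniformSphere (volume : Measure E))) ^ 2 / 8) := by
  haveI : (uniformSphere (volume : Measure E)).IsOpenPosMeasure := by
    rw [uniformSphere]
    exact Measure.isOpenPosMeasure_smul _ (ENNReal.inv_ne_zero.2 (measure_ne_top _ _))
  haveI : (Measure.pi (fun _ : Λ => uniformSphere (volume : Measure E))).IsOpenPosMeasure :=
    Measure.pi.isOpenPosMeasure _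
  have hAc : Continuous (coordAvg (uniformSphere (volume : Measure E)) C h) := continuous_coordAvg _ _ hh
  have hmean : ∫ ω, coordAvg (uniformSphere (volume : Measure E)) C h ω
      ∂Measure.pi (fun _ : Λ => uniformSphere (volume : Measure E)) =
      ∫ ω, h ω ∂Measure.pi (fun _ : Λ => uniformSphere (volume : Measure E)) := integral_coordAvg _ _ hh
  have hpos := integral_abs_sub_mean_pos_of_ne
    (P := Measure.pi (fun _ : Λ => uniformSphere (volume : Measure E))) hAc hne
  rw [hmean] at hpos
  exact ⟨hpos, Real.log_pos (by nlinarith)⟩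

end Floor

end Summit.Ventures.LatticeQCDFlow.Exactness

end
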